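import Summits.QuantumAdvantage.QuantumAdvantage.Theorems.LocusDialPieces
import Summits.QuantumAdvantage.QuantumAdvantage.Theorems.LocusDialRung

/-!
# LocusDial — part 3 «Pointer» (cell decomp-qadv, seat lens-2, generation 16; supports item 26531 `ExactnessDial.PolyLossOddU3`)

§6–§7 of the g16 node «LocusDial», re-namespaced to `…Theorems.LocusDial`.  The leaves under `U`: `FreePointerLoss3`
(one freely located declared position, exact uniqueness in polylog degree, NO stability) with the necessity
`freePointerLoss3_of_fewLocusLoss3` (via `dev (mpStrat A 1) x = {k(x)}`), and `AffinePointerLoss3` (the position is any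
function of `t ≤ (log₂ n)^c` `𝔽₃`-linear forms of the bits) with the necessity
`affinePointerLoss3_of_freePointerLoss3` (fibre-indicator anchors `hashAnchor` of degree `2t`, exactly one declared
position on every input).  Prop definitions = the node's leaves only.  No `sorry`; standard axioms.
-/

set_option linter.dupNamespace false

noncomputable section

open scoped Classical

namespace Summit.QuantumAdvantage.QuantumAdvantage.Theorems.LocusDial

open Finset
open Literature.Computability.QuantumComplexity Literature.Computability.QuantumComplexity.RingHLF
open Literature.Computability.MetaComplexity Literature.Computability.MetaComplexity.Smolensky
open Summit.QuantumAdvantage.AdviceFreeQNC0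
open Summit.QuantumAdvantage.QuantumAdvantage.Theses (ExactnessDial.PolyLossOddU3 ExactnessDial.DPLift3)
open Summit.QuantumAdvantage.QuantumAdvantage.Theorems.HolonomyDial (gCond selP selP_mem selP_apply xorP xorP_mem
  xorP_apply_bool tPoly tPoly_mem tPoly_apply mono_singleton_apply closes_T card_odd_le)
open Summit.QuantumAdvantage.QuantumAdvantage.Theorems.AnchorDial (flip2 flip2_flip2 flip2_apply_of_ne oddZeros_flip2
  card_filter_flip2 zpar_flip2 outB dev cN gCond_iff_cN win_iff devInd mpStrat devInd_mem mpStrat_mem devInd_apply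
  rel_mpStrat_iff deg_bump4 loss_shape_mono real_tail card_odd_ge MAnchorable MultiAnchorLoss3 NoMultiAnchorLoss3
  multiAnchorLoss3_of_polyLossOddU3 noMultiAnchorLoss3_of_polyLossOddU3 polyLossOddU3_of_dichotomy
  polyLossOddU3_iff_multiAnchor multiAnchorLoss3_slice_one mAnchorable_mono_m MovingPointerLoss3
  movingPointerLoss3_of_polyLossOddU3 fz fz_apply zpar_fz oddZeros_fz cN_fz sh sgN mod3_ne_two_iff)

variable {N : ℕ}

/-! ## §6  Leaf under `U`: the FREE POINTER (`m = 1`, `r = 0`, exact unique declaration, NO stability) -/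

/-- **`FreePointerLoss3`** — the LOCALISATION CORE of `U`: a polylog-degree anchor family `A_k` declaring EXACTLY ONE
position `k(x)` on every odd input (no flip-stability, no structure on HOW the position is computed) hits a kernel
position `g_{k(x)}(x) = 1` on at most a `1 - n^{-C}` fraction of the odd class.  NECESSARY for `U`
(`freePointerLoss3_of_fewLocusLoss3`: the strategy `mpStrat A 1` bets exactly at `k(x)`).  g14's PROVED
`MovingPointerLoss3` is this law PLUS the stability hypothesis STAB; dropping STAB is the whole difficulty. -/
def FreePointerLoss3 : Prop :=
  ∃ C : ℕ, ∀ c : ℕ, ∃ n₀ : ℕ, ∀ n ≥ n₀, ∀ A : Fin n → CubeFn (ZMod 3) n,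
    (∀ k, A k ∈ lowDeg (ZMod 3) n ((Nat.log 2 n) ^ c)) →
    (∀ x : Fin n → Bool, OddZeros x → (univ.filter fun k : Fin n => A k x = 1).card = 1) →
      ((univ.filter fun x : Fin n → Bool => OddZeros x ∧ ∃ k : Fin n, A k x = 1 ∧ gCond x k.val).card : ℝ) ≤
        (1 - 1 / (n : ℝ) ^ C) * (2 : ℝ) ^ (n - 1)

/-- deviation set of the moving-pointer strategy on a uniquely anchored input (the computation inside the tree's
`rel_mpStrat_iff`, exported). -/
theorem dev_mpStrat (hN : 1 ≤ N) (A f : Fin N → CubeFn (ZMod 3) N) (x : Fin N → Bool) (k₀ : Fin N)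
    (huniq : (univ.filter fun k' : Fin N => A k' x = 1) = {k₀}) :
    dev (mpStrat A f) x = {⟨(k₀.val + (if f k₀ x = 1 then 0 else 1)) % N, Nat.mod_lt _ (by omega)⟩} := by
  ext i
  simp only [dev, mem_filter, mem_univ, true_and, mem_singleton]
  have hout : decide (mpStrat A f i x = 1) =
      xor (tGuess x i) (decide (i.val = (k₀.val + (if f k₀ x = 1 then 0 else 1)) % N)) := by
    have hq : devInd A f i x = if decide (i.val = (k₀.val + (if f k₀ x = 1 then 0 else 1)) % N) then 1 else 0 := by
      rw [devInd_apply A f x k₀ huniq i]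
      by_cases h : i.val = (k₀.val + (if f k₀ x = 1 then 0 else 1)) % N <;> simp [h]
    have h := xorP_apply_bool (tPoly i) (devInd A f i) x (tGuess x i) _ (tPoly_apply i x) hq
    show decide (xorP (tPoly i) (devInd A f i) x = 1) = _
    rw [h]
    cases xor (tGuess x i) (decide (i.val = (k₀.val + (if f k₀ x = 1 then 0 else 1)) % N)) <;> decide
  rw [hout, Fin.ext_iff]
  show _ ↔ i.val = (k₀.val + (if f k₀ x = 1 then 0 else 1)) % N
  cases tGuess x i <;> by_cases h : i.val = (k₀.val + (if f k₀ x = 1 then 0 else 1)) % N <;> simp [h]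

/-- with the constant selector `f ≡ 1` the deviation sits AT the declared position. -/
theorem dev_mpStrat_one (hN : 1 ≤ N) (A : Fin N → CubeFn (ZMod 3) N) (x : Fin N → Bool) (k₀ : Fin N)
    (huniq : (univ.filter fun k' : Fin N => A k' x = 1) = {k₀}) :
    dev (mpStrat A (fun _ => 1)) x = {k₀} := by
  rw [dev_mpStrat hN A _ x k₀ huniq, Finset.singleton_inj]
  apply Fin.ext
  simp [Nat.mod_eq_of_lt k₀.isLt]

/-- LocusDialPointer helper `rel_mpStrat_one` (decomp-qadv land package; see the module docstring). -/
theorem rel_mpStrat_one (hN : 3 ≤ N) (A : Fin N → CubeFn (ZMod 3) N) (x : Fin N → Bool) (hx : OddZeros x)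
    (k₀ : Fin N) (huniq : (univ.filter fun k' : Fin N => A k' x = 1) = {k₀}) :
    Rel x (outB (mpStrat A (fun _ => 1)) x) ↔ gCond x k₀.val := by
  rw [rel_mpStrat_iff hN A _ x hx k₀ huniq]
  simp [Nat.mod_eq_of_lt k₀.isLt]

/-- LocusDialPointer helper `filter_eq_singleton_of_card` (decomp-qadv land package; see the module docstring). -/
theorem filter_eq_singleton_of_card {A : Fin N → CubeFn (ZMod 3) N} {x : Fin N → Bool}
    (h : (univ.filter fun k : Fin N => A k x = 1).card = 1) {k : Fin N} (hk : A k x = 1) :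
    (univ.filter fun k' : Fin N => A k' x = 1) = {k} := by
  obtain ⟨k₀, hk₀⟩ := card_eq_one.1 h
  have hmem : k ∈ ({k₀} : Finset (Fin N)) := by rw [← hk₀]; exact mem_filter.2 ⟨mem_univ _, hk⟩
  rw [mem_singleton] at hmem
  rw [hk₀, hmem]

/-- **NECESSITY `U → FreePointerLoss3`**: the free pointer's strategy `mpStrat A 1` (degree
`2 + 4(log₂ n)^c ≤ (log₂ n)^{c+1}`) has deviation set `{k(x)}` — ONE window of width `0` — on every odd input, so it
is few-locus at `(1, 0)` with EMPTY exceptional set, and it wins exactly where the declared position is a kernel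
position. -/
theorem freePointerLoss3_of_fewLocusLoss3 (h : FewLocusLoss3) : FreePointerLoss3 := by
  obtain ⟨C, hC⟩ := h
  refine ⟨C, fun c => ?_⟩
  obtain ⟨n₀, hn₀⟩ := hC 1 0 (c + 1)
  refine ⟨max n₀ 64, fun n hn A hA huniq => ?_⟩
  have hn64 : 64 ≤ n := le_of_max_le_right hn
  have hQ : ∀ i, mpStrat A (fun _ => 1) i ∈ lowDeg (ZMod 3) n ((Nat.log 2 n) ^ (c + 1)) := fun i =>
    lowDeg_mono (deg_bump4 n c hn64) (mpStrat_mem hA (fun _ => one_mem_lowDeg _) i)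
  have hfew : FewLocus 1 0 (mpStrat A (fun _ => 1)) := by
    unfold FewLocus
    have h0 : (univ.filter fun x : Fin n → Bool =>
        OddZeros x ∧ ¬ Coverable 1 0 (dev (mpStrat A (fun _ => 1)) x)) = ∅ := by
      refine filter_eq_empty_iff.2 fun x _ hx => hx.2 ?_
      obtain ⟨k₀, hk₀⟩ := card_eq_one.1 (huniq x hx.1)
      rw [dev_mpStrat_one (by omega) A x k₀ hk₀]
      exact coverable_singleton le_rfl 0 k₀
    rw [h0, card_empty, mul_zero]
    exact Nat.zero_le _
  have hle := hn₀ n (le_of_max_le_left hn) _ hQ hfew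
  refine le_trans ?_ hle
  have hsub : (univ.filter fun x : Fin n → Bool => OddZeros x ∧ ∃ k : Fin n, A k x = 1 ∧ gCond x k.val) ⊆
      univ.filter fun x : Fin n → Bool =>
        OddZeros x ∧ Rel x (fun i => decide (mpStrat A (fun _ => 1) i x = 1)) := by
    intro x hx
    rw [mem_filter] at hx ⊢
    obtain ⟨-, hodd, k, hk, hg⟩ := hx
    exact ⟨mem_univ _, hodd,
      (rel_mpStrat_one (by omega) A x hodd k (filter_eq_singleton_of_card (huniq x hodd) hk)).2 hg⟩
  exact_mod_cast card_le_card hsub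

/-- `T → FreePointerLoss3`. -/
theorem freePointerLoss3_of_polyLossOddU3 (h : ExactnessDial.PolyLossOddU3) : FreePointerLoss3 :=
  freePointerLoss3_of_fewLocusLoss3 (fewLocusLoss3_of_polyLossOddU3 h)

/-! ## §7  Leaf under the free pointer: the AFFINELY HASHED pointer -/

/-- **`AffinePointerLoss3`**: no pointer that is an ARBITRARY function `π` of `t ≤ (log₂ n)^c` `𝔽₃`-linear forms of the
input bits hits a kernel position on all but a polynomial fraction of the odd class.  A purely combinatorial
statement; NECESSARY for the free pointer (`affinePointerLoss3_of_freePointerLoss3`: the hashed pointer is a free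
pointer of degree `2t`), hence for `U` and `T`.  ATTACKABLE (transfer-operator exponential sums in the prefix-parity
coordinates; or fibre-neutral toggles, §8). -/
def AffinePointerLoss3 : Prop :=
  ∃ C : ℕ, ∀ c : ℕ, ∃ n₀ : ℕ, ∀ n ≥ n₀, ∀ t : ℕ, t ≤ (Nat.log 2 n) ^ c →
    ∀ M : Fin t → Fin n → ZMod 3, ∀ π : (Fin t → ZMod 3) → Fin n,
      ((univ.filter fun x : Fin n → Bool => OddZeros x ∧ gCond x (π (linHash M x)).val).card : ℝ) ≤
        (1 - 1 / (n : ℝ) ^ C) * (2 : ℝ) ^ (n - 1)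

/-- the linear form `L_s` as a cube function (degree `1`). -/
def linPoly {t : ℕ} (M : Fin t → Fin N → ZMod 3) (s : Fin t) : CubeFn (ZMod 3) N :=
  ∑ i : Fin N, M s i • mono (ZMod 3) {i}

/-- LocusDialPointer helper `linPoly_apply` (decomp-qadv land package; see the module docstring). -/
theorem linPoly_apply {t : ℕ} (M : Fin t → Fin N → ZMod 3) (s : Fin t) (x : Fin N → Bool) :
    linPoly M s x = linHash M x s := by
  unfold linPoly linHash
  rw [Finset.sum_apply]
  refine sum_congr rfl fun i _ => ?_
  rw [Pi.smul_apply, mono_singleton_apply, smul_eq_mul]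

/-- LocusDialPointer helper `linPoly_mem` (decomp-qadv land package; see the module docstring). -/
theorem linPoly_mem {t : ℕ} (M : Fin t → Fin N → ZMod 3) (s : Fin t) : linPoly M s ∈ lowDeg (ZMod 3) N 1 :=
  Submodule.sum_mem _ fun i _ => Submodule.smul_mem _ _ (mono_mem_lowDeg (by simp))

/-- the affine form `L_s - v_s` (degree `1`). -/
def affPoly {t : ℕ} (M : Fin t → Fin N → ZMod 3) (v : Fin t → ZMod 3) (s : Fin t) : CubeFn (ZMod 3) N :=
  linPoly M s - v s • (1 : CubeFn (ZMod 3) N)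

/-- LocusDialPointer helper `affPoly_apply` (decomp-qadv land package; see the module docstring). -/
theorem affPoly_apply {t : ℕ} (M : Fin t → Fin N → ZMod 3) (v : Fin t → ZMod 3) (s : Fin t) (x : Fin N → Bool) :
    affPoly M v s x = linHash M x s - v s := by
  unfold affPoly
  rw [Pi.sub_apply, Pi.smul_apply, Pi.one_apply, linPoly_apply, smul_eq_mul, mul_one]

/-- LocusDialPointer helper `affPoly_mem` (decomp-qadv land package; see the module docstring). -/
theorem affPoly_mem {t : ℕ} (M : Fin t → Fin N → ZMod 3) (v : Fin t → ZMod 3) (s : Fin t) :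
    affPoly M v s ∈ lowDeg (ZMod 3) N 1 :=
  Submodule.sub_mem _ (linPoly_mem M s) (Submodule.smul_mem _ _ (one_mem_lowDeg _))

/-- the FIBRE INDICATOR `[L(x) = v] = Π_s (1 - (L_s - v_s)²)` (degree `2t`). -/
def fibInd {t : ℕ} (M : Fin t → Fin N → ZMod 3) (v : Fin t → ZMod 3) : CubeFn (ZMod 3) N :=
  ∏ s : Fin t, (1 - affPoly M v s * affPoly M v s)

/-- LocusDialPointer helper `sq_ind` (decomp-qadv land package; see the module docstring). -/
theorem sq_ind : ∀ z : ZMod 3, 1 - z * z = if z = 0 then 1 else 0 := by decide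

/-- LocusDialPointer helper `fibInd_apply` (decomp-qadv land package; see the module docstring). -/
theorem fibInd_apply {t : ℕ} (M : Fin t → Fin N → ZMod 3) (v : Fin t → ZMod 3) (x : Fin N → Bool) :
    fibInd M v x = if linHash M x = v then 1 else 0 := by
  unfold fibInd
  rw [Finset.prod_apply]
  have e : ∀ s, (1 - affPoly M v s * affPoly M v s) x = if linHash M x s = v s then 1 else 0 := fun s => by
    rw [Pi.sub_apply, Pi.mul_apply, Pi.one_apply, affPoly_apply, sq_ind]
    exact if_congr sub_eq_zero rfl rfl
  simp_rw [e]
  by_cases h : linHash M x = v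
  · rw [if_pos h]
    exact prod_eq_one fun s _ => by rw [if_pos (congrFun h s)]
  · rw [if_neg h]
    obtain ⟨s, hs⟩ : ∃ s, linHash M x s ≠ v s := by
      by_contra hc
      exact h (funext fun s => not_not.1 (not_exists.1 hc s))
    exact prod_eq_zero (mem_univ s) (by rw [if_neg hs])

/-- LocusDialPointer helper `fibInd_mem` (decomp-qadv land package; see the module docstring). -/
theorem fibInd_mem {t : ℕ} (M : Fin t → Fin N → ZMod 3) (v : Fin t → ZMod 3) :
    fibInd M v ∈ lowDeg (ZMod 3) N (t * 2) := by
  unfold fibInd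
  have h := prod_mem_lowDeg_card_mul (F := ZMod 3) (univ : Finset (Fin t))
    (fun s => 1 - affPoly M v s * affPoly M v s) fun s _ =>
      Submodule.sub_mem _ (one_mem_lowDeg _) (mul_mem_lowDeg_add (affPoly_mem M v s) (affPoly_mem M v s))
  simpa using h

/-- the ANCHOR FAMILY of a hashed pointer: `A_k = Σ_{v : π v = k} [L = v]` (degree `2t`). -/
def hashAnchor {t : ℕ} (M : Fin t → Fin N → ZMod 3) (π : (Fin t → ZMod 3) → Fin N) (k : Fin N) :
    CubeFn (ZMod 3) N :=
  ∑ v ∈ univ.filter (fun v : Fin t → ZMod 3 => π v = k), fibInd M v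

/-- LocusDialPointer helper `hashAnchor_apply` (decomp-qadv land package; see the module docstring). -/
theorem hashAnchor_apply {t : ℕ} (M : Fin t → Fin N → ZMod 3) (π : (Fin t → ZMod 3) → Fin N) (k : Fin N)
    (x : Fin N → Bool) : hashAnchor M π k x = if π (linHash M x) = k then 1 else 0 := by
  unfold hashAnchor
  rw [Finset.sum_apply]
  simp_rw [fibInd_apply]
  rw [Finset.sum_ite_eq]
  simp only [mem_filter, mem_univ, true_and]

/-- LocusDialPointer helper `hashAnchor_mem` (decomp-qadv land package; see the module docstring). -/
theorem hashAnchor_mem {t : ℕ} (M : Fin t → Fin N → ZMod 3) (π : (Fin t → ZMod 3) → Fin N) (k : Fin N) :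
    hashAnchor M π k ∈ lowDeg (ZMod 3) N (t * 2) :=
  Submodule.sum_mem _ fun v _ => fibInd_mem M v

/-- the hashed pointer declares EXACTLY ONE position on every input. -/
theorem hashAnchor_filter {t : ℕ} (M : Fin t → Fin N → ZMod 3) (π : (Fin t → ZMod 3) → Fin N)
    (x : Fin N → Bool) : (univ.filter fun k : Fin N => hashAnchor M π k x = 1) = {π (linHash M x)} := by
  ext k
  rw [mem_filter, mem_singleton, hashAnchor_apply]
  by_cases h : π (linHash M x) = k
  · rw [if_pos h]; exact ⟨fun _ => h.symm, fun _ => ⟨mem_univ _, rfl⟩⟩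
  · rw [if_neg h]; exact ⟨fun h0 => absurd h0.2 zero_ne_one, fun hk => absurd hk.symm h⟩

/-- **NECESSITY `FreePointerLoss3 → AffinePointerLoss3`**: the hashed pointer is a free pointer of degree
`2t ≤ (log₂ n)^{c+1}` with exact unique declaration on EVERY input. -/
theorem affinePointerLoss3_of_freePointerLoss3 (h : FreePointerLoss3) : AffinePointerLoss3 := by
  obtain ⟨C, hC⟩ := h
  refine ⟨C, fun c => ?_⟩
  obtain ⟨n₀, hn₀⟩ := hC (c + 1)
  refine ⟨max n₀ 4, fun n hn t ht M π => ?_⟩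
  have hn4 : 4 ≤ n := le_of_max_le_right hn
  have hdeg : t * 2 ≤ (Nat.log 2 n) ^ (c + 1) := by
    have hL : 2 ≤ Nat.log 2 n := Nat.le_log_of_pow_le (by norm_num) (by norm_num; omega)
    rw [pow_succ]
    exact Nat.mul_le_mul ht hL
  have hA : ∀ k, hashAnchor M π k ∈ lowDeg (ZMod 3) n ((Nat.log 2 n) ^ (c + 1)) := fun k =>
    lowDeg_mono hdeg (hashAnchor_mem M π k)
  have huniq : ∀ x : Fin n → Bool, OddZeros x →
      (univ.filter fun k : Fin n => hashAnchor M π k x = 1).card = 1 := fun x _ => by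
    rw [hashAnchor_filter, card_singleton]
  have hle := hn₀ n (le_of_max_le_left hn) _ hA huniq
  have hset : (univ.filter fun x : Fin n → Bool => OddZeros x ∧ gCond x (π (linHash M x)).val) =
      univ.filter fun x : Fin n → Bool =>
        OddZeros x ∧ ∃ k : Fin n, hashAnchor M π k x = 1 ∧ gCond x k.val := by
    refine filter_congr fun x _ => and_congr_right fun _ => ⟨fun hg => ⟨π (linHash M x), ?_, hg⟩, ?_⟩
    · rw [hashAnchor_apply, if_pos rfl]
    · rintro ⟨k, hk, hg⟩
      rw [hashAnchor_apply] at hk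
      by_cases hpk : π (linHash M x) = k
      · rw [hpk]; exact hg
      · rw [if_neg hpk] at hk; exact absurd hk zero_ne_one
  rw [hset]
  exact hle

/-- `T → AffinePointerLoss3`. -/
theorem affinePointerLoss3_of_polyLossOddU3 (h : ExactnessDial.PolyLossOddU3) : AffinePointerLoss3 :=
  affinePointerLoss3_of_freePointerLoss3 (freePointerLoss3_of_polyLossOddU3 h)


end Summit.QuantumAdvantage.QuantumAdvantage.Theorems.LocusDial

end
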